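import Summits.SmoothPoincare4.SmoothPoincare4.Theses.SymplecticOrigami
import Summits.SmoothPoincare4.SmoothPoincare4.Theorems.OrigamiFoldExistence.Negative.ZeroSlack

/-!
# `OrigamiFoldExistence` — negative-side support: zero slack, sharp form (crux stmt-SmoothPoincare4-7844)

Standing disprover's bookkeeping (work file `Cruxes/OrigamiFoldExistence/Disproof.lean`, §2),
sharpening `Negative.ZeroSlack` (p72874):

* `not_origamiFoldExistence_of_not_roundSphere` : the route's support item
  `RoundSphereIsOrigamiFold` (RS, stmt-7845) is a CONSEQUENCE of the crux E — E instantiated at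
  `M := S⁴`, `e := HomotopyEquiv.refl` is literally RS (the bodies agree definitionally); stated
  negatively (`¬ RS → ¬ E`) as befits this lane;
* `origamiFoldExistence_iff_smoothPoincare4_and_roundSphere` : modulo the route's other two cruxes
  R = `OrigamiRung` and D = `NoGenusTwoDoor` ONLY, the crux is EQUIVALENT to
  `SmoothPoincare4 ∧ RoundSphereIsOrigamiFold` — the previous two-sided zero-slack statement needed
  RS as a standing hypothesis on both sides; here it is part of the right-hand side.

Reading for the crux chain: every proof of E proves RS on the way (so the L-rated item 7845 is not
optional formal debt but the `M = S⁴` case of the crux), and every disproof of E is either a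
disproof of RS (a TYPING defect of the fold data at the round sphere — audited conjunct by conjunct
in the work file, none found) or an exotic 4-sphere.
-/

noncomputable section

-- the prescribed namespace `Summit.<P>.<Sub>.…` duplicates `SmoothPoincare4` (P = Sub)
set_option linter.dupNamespace false

open scoped Manifold ContDiff Topology ContinuousMap

namespace Summit.SmoothPoincare4.SmoothPoincare4.Theorems.OrigamiFoldExistence.Negative

open Summit.SmoothPoincare4.SmoothPoincare4.Theses.SymplecticOrigami

/-- **No round-sphere fold, no crux**: `OrigamiFoldExistence` applied to Mathlib's unit sphere
in `ℝ⁵` and the identity homotopy equivalence is, verbatim, the support item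
`RoundSphereIsOrigamiFold`; so a failure of the typed fold data at the round sphere (a typing
defect — audited conjunct by conjunct in the work file, none found) would refute the crux, and
every proof of the crux proves item stmt-7845 on the way. [folklore] -/
theorem not_origamiFoldExistence_of_not_roundSphere (h : ¬ RoundSphereIsOrigamiFold) :
    ¬ OrigamiFoldExistence :=
  fun hE => h (hE (Metric.sphere (0 : EuclideanSpace ℝ (Fin 5)) 1) (ContinuousMap.HomotopyEquiv.refl _))

/-- **Zero slack, sharp form.** Modulo the rung `OrigamiRung` and the door `NoGenusTwoDoor`, the
crux `OrigamiFoldExistence` is equivalent to the conjunction of the smooth 4-dimensional Poincaré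
conjecture and the round-sphere fold: `→` is the route's deciding theorem `closes` together with
the `M = S⁴` instance of the crux; `←` is transport of the fold data along diffeomorphisms
(`origamiFoldExistence_of_smoothPoincare4`, p72874). [folklore] -/
theorem origamiFoldExistence_iff_smoothPoincare4_and_roundSphere (hR : OrigamiRung)
    (hD : NoGenusTwoDoor) :
    OrigamiFoldExistence ↔ _root_.SmoothPoincare4 ∧ RoundSphereIsOrigamiFold :=
  ⟨fun hE => ⟨closes hR hD hE,
      hE (Metric.sphere (0 : EuclideanSpace ℝ (Fin 5)) 1) (ContinuousMap.HomotopyEquiv.refl _)⟩,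
    fun h => origamiFoldExistence_of_smoothPoincare4 h.1 h.2⟩

/-- **A disproof of the crux that is not an exotic sphere is a disproof of the round-sphere
fold.** Contrapositive bookkeeping: if SPC4 holds, `¬ E` forces `¬ RS`. [folklore] -/
theorem not_roundSphere_of_not_origamiFoldExistence (hS : _root_.SmoothPoincare4)
    (hE : ¬ OrigamiFoldExistence) : ¬ RoundSphereIsOrigamiFold :=
  fun hRS => hE (origamiFoldExistence_of_smoothPoincare4 hS hRS)

end Summit.SmoothPoincare4.SmoothPoincare4.Theorems.OrigamiFoldExistence.Negative

end
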